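import Summits.QuantumFields.YangMills.Theorems.BalabanUVNodesN08HaarCompatibilityGuardJacobianSharpNorm
import Literature.MathematicalPhysics.QuantumFieldTheory.Balaban1983to89.T4AdjointCovarianceUnitary
import Literature.MathematicalPhysics.QuantumLattice.RepLieAlgebraUnitary
import Mathlib.MeasureTheory.Measure.Lebesgue.EqHaar
import Mathlib.Analysis.Calculus.Deriv.Mul
import Mathlib.Analysis.Calculus.Deriv.Star
import Mathlib.Analysis.SpecialFunctions.Exponential

/-!
# BalabanUVNodes ∕ N08 — THE DETERMINANT FORM OF THE SHARP JACOBIAN BOUND OF THE PRINTED exp-mean-log FIBRE MAP: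
# `(1 − Σcᵢ)^(N²) ≤ |det T|` for the left-trivialised tangent map `T X = K_W* · D K_W (W X)` on `𝔲(N)`, equality at the flat background

WIDTH SEAT `pub-ymgap-dag-n08-w6` g4 (R399 (3a) second wave; self-located CLAIM-1 of record HOME INBOX l.31429, the successor piece (t7) of this
seat's g3 lineage p609767 ✓ ∕ p610204 ✓ ∕ p611548 ✓ ∕ p612264 ✓), 2026-08-28.  Track A, DAG node N08 = [Balaban1985UV3] Thm 1 p. 257 (compact) +
Thm 2 p. 272; key item K1⁷ `StabilityBAtRecordR13SepCoPH` (stmt-QuantumFields-20542), `--supports … --as helper`.  COUNT-NEUTRAL.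

THE POINT.  `K_W = Kmat h c W = exp(Σᵢ cᵢ log(hᵢ W*))·W` (pub-balaban's `T4EMLTangentInjective.Kmat`; unitary `W`, unitaries `hᵢ` in the guard
`‖hᵢW* − 1‖ < 1∕2`, `cᵢ ≥ 0`, `Σcᵢ ≤ 1`, `λ := 1 − Σcᵢ`; at the [B10] slot `λ = L^{1−d}`) is the one-variable fibre map of the printed (0.4)∕(1.4)
averaging, with explicit strict derivative `D K_W = emlD h c W`.  Part 3b of the series (g3, p612264 `…SharpNorm.emlD_tangent_lower_bound_sharp`) proved
the SINGULAR-VALUE form `λ²·hs(X, X) ≤ hs(D K_W(WX), D K_W(WX))` (Hilbert–Schmidt norm, skew-Hermitian `X`).  What a fibre-law DENSITY constant reads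
(sibling n08-w3's p610482 `…GuardMixtureDensity`, «Jacobian ≥ (1 − Σcᵢ)^{…} per n08-w6's sharp form … through a quantitative local-diffeomorphism
engine») is the JACOBIAN DETERMINANT of `K` relative to Haar measure, i.e. `|det|` of the tangent map read in left-trivialised tangent spaces.  THIS FILE
TYPES THAT PASSAGE:
* §1 [folklore] GENERIC: an `ℝ`-linear endomorphism `f` of a finite-dimensional real normed space (ANY norm) with `λ‖x‖ ≤ ‖f x‖`, `λ ≥ 0`, has
  `λ^(dim) ≤ |LinearMap.det f|` (`pow_finrank_le_abs_det_of_mul_norm_le`; Haar measure of balls: `ball 0 λ ⊆ f(ball 0 1)`, Mathlib's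
  `addHaar_image_linearMap` ∕ `addHaar_ball_of_pos`); a homothety `λ·id` has `det = λ^(dim)` (`det_eq_pow_finrank_of_eq_smul`).
* §2 on pub-balaban's `𝔲(N) = lieU` (`T4AdjointCovarianceUnitary`, PINNED Hilbert–Schmidt norm): `‖X‖² = hs X X` (`norm_sq_eq_hs`), `dim_ℝ 𝔲(N) = N²`
  (`finrank_lieU`, the tree's `QuantumLattice.finrank_skewAdjoint_submodule`), hence §1 in `hs`-form: `λ²·hs(X,X) ≤ hs(TX,TX) ⟹ λ^(N²) ≤ |det T|`
  (`pow_card_sq_le_abs_det_of_hs_le`).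
* §3 TANGENCY (`star_kmat_mul_emlD_skew`, `star_kmat_mul_emlD_mem_lieU`): `K_W* · D K_W (W X)` IS skew-Hermitian for skew-Hermitian `X` — `K` maps the
  guarded unitaries into `U(N)` (`kmat_mem_unitaryGroup`: the `log(hᵢM*)` are skew by pub-balaban's `star_mlog_of_unitary`), the curve `t ↦ W e^{tX}` stays
  unitary and inside the (open) guard for small `t`, `d∕dt K(W e^{tX})|₀ = D K_W(W X)` (`hasDerivAt_kmat_mul_exp_smul`, pub-balaban's
  `hasStrictFDerivAt_Kmat` + chain rule), and differentiating `K(W e^{tX})* K(W e^{tX}) = 1` at `t = 0` gives `(D K_W(WX))* K_W + K_W* D K_W(WX) = 0`.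
* §4 ★ `exists_leftTangent_lieU`: the left-trivialised tangent map exists as an `ℝ`-linear endomorphism `T` of `𝔲(N)` (non-vacuity, A6);
  ★★★ **`pow_card_sq_le_abs_det_leftTangent`**: for EVERY `T : 𝔲(N) →ₗ[ℝ] 𝔲(N)` with `T X = K_W* · D K_W (W X)` (definition-free: a consumer builds `T`
  as it likes and checks the pointwise formula), `(1 − Σcᵢ)^(N²) ≤ |LinearMap.det T|` — from part 3b and §2, `K_W*·` being an `hs`-isometry
  (`hs_unitary_mul`); ★ `det_leftTangent_flat`: at the flat background `hᵢ = W` (part 14's `emlD_flat`, `K_W = W`) `T = (1 − Σcᵢ)·id` and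
  `det T = (1 − Σcᵢ)^(N²)` — base AND exponent attained; ★★ `pow_card_sq_le_abs_det_leftTangent_specialUnitary`: the reading at the typed guard
  `ExpMeanLog.deltaSU = min(1∕3, π∕N)` of the printed average on `SU(N)`, every `N`, one `W`-uniform constant.
NOT HERE (INTENT-2, separate file): the `𝔰𝔲(N) = lieSU` edition — trace preservation of `T` on the `deltaSU` guard and the exponent `N² − 1`
(`QuantumLattice.finrank_skewAdjoint_inf_ker_trace`), which is the Jacobian an `SU(N)`-Haar density constant reads.

HONEST FRAMING.  Count-neutral helper: [folklore] linear algebra ∕ matrix calculus ∕ measure theory about the printed (0.4)∕(1.4) fibre map, over pub-balaban's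
`Kmat`∕`emlD`∕`lieU` and Mathlib BY IMPORT; NO quantitative `T4HaarUnitaryLocalDiffeo`∕`T4HaarSUNLocalDiffeo` engine, NO density bound, NO sheet count is
typed here; nothing of Bałaban's is asserted; E6′ NOT decided; `hmass` NOT supplied; N08 NOT discharged; counts unmoved (typed 28∕28 · discharged 5∕27);
no summit statement is proved by this seat — one finite 𝕋⁴ programme at fixed ε, R4 closes the CONDITIONAL rung `BalabanLadder.UV` only; the Yang–Mills
mass gap (Clay) is NOT proved by any of this; nothing continuum ∕ ℝ⁴ ∕ OS ∕ mass gap.  0 `sorry`, 0 `def`, 0 `instance`, 0 `notation`, standard axioms.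
-/

noncomputable section

open NormedSpace Finset
open scoped Matrix ComplexConjugate

namespace Summit.QuantumFields.YangMills.BalabanUVNodes.N08HaarCompatibilityGuardJacobianDet

open Literature.MathematicalPhysics.QuantumFieldTheory.Balaban1983to89
open Literature.MathematicalPhysics.QuantumFieldTheory.Balaban1983to89.T4EMLTangentInjective
open Literature.MathematicalPhysics.QuantumFieldTheory.Balaban1983to89.T4AdjointCovarianceUnitary
  (lieU mem_lieU_iff exp_mem_unitaryGroup_of_mem_lieU)
open Summit.QuantumFields.YangMills.BalabanUVNodes.N08HaarCompatibilityGuardJacobian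
open Summit.QuantumFields.YangMills.BalabanUVNodes.N08HaarCompatibilityGuardJacobianSharpNorm
open Matrix (unitaryGroup)
open Literature.MathematicalPhysics.QuantumFieldTheory.Balaban1983to89.MatrixLog (mlog)

/-! ## §1 A linear endomorphism expanding every vector by `λ` has `|det| ≥ λ^dim` -/

section Generic

open MeasureTheory Metric Module

variable {E : Type*} [NormedAddCommGroup E] [NormedSpace ℝ E] [FiniteDimensional ℝ E]

/-- **An expanding endomorphism has a large determinant.**  If `f` is an `ℝ`-linear endomorphism of a finite-dimensional real
normed space (ANY norm) with `λ‖x‖ ≤ ‖f x‖` for all `x`, `λ ≥ 0`, then `λ^(dim E) ≤ |det f|`.  Proof by Haar measure: for `λ > 0`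
the map is bijective and `f(ball 0 1) ⊇ ball 0 λ`, so `λ^dim · vol(ball 0 1) = vol(ball 0 λ) ≤ vol(f(ball 0 1)) = |det f| · vol(ball 0 1)`
(`addHaar_ball_of_pos`, `addHaar_image_linearMap`). [folklore] -/
theorem pow_finrank_le_abs_det_of_mul_norm_le (f : E →ₗ[ℝ] E) {l : ℝ} (hl : 0 ≤ l) (hf : ∀ x, l * ‖x‖ ≤ ‖f x‖) :
    l ^ finrank ℝ E ≤ |LinearMap.det f| := by
  rcases hl.eq_or_lt with h0 | hl0
  · rw [← h0]
    rcases Nat.eq_zero_or_pos (finrank ℝ E) with hd | hd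
    · rw [hd, pow_zero, LinearMap.det_eq_one_of_finrank_eq_zero hd, abs_one]
    · rw [zero_pow hd.ne']; exact abs_nonneg _
  · borelize E
    let μ : Measure E := (Module.finBasis ℝ E).addHaar
    have hinj : Function.Injective f := by
      intro x y hxy
      have h1 : l * ‖x - y‖ ≤ ‖f (x - y)‖ := hf (x - y)
      rw [map_sub, hxy, sub_self, norm_zero] at h1
      have h2 : ‖x - y‖ ≤ 0 := by
        by_contra hcon
        push Not at hcon
        have := mul_pos hl0 hcon
        linarith
      exact sub_eq_zero.1 (norm_le_zero_iff.1 h2)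
    have hsurj : Function.Surjective f := LinearMap.injective_iff_surjective.1 hinj
    have hball : ball (0 : E) l ⊆ f '' ball 0 1 := by
      intro y hy
      obtain ⟨x, rfl⟩ := hsurj y
      refine ⟨x, ?_, rfl⟩
      rw [mem_ball_zero_iff] at hy ⊢
      by_contra hx
      push Not at hx
      have h1 := hf x
      have h2 : l * 1 ≤ l * ‖x‖ := mul_le_mul_of_nonneg_left hx hl
      linarith
    have h1 : μ (ball (0 : E) l) ≤ μ (f '' ball 0 1) := measure_mono hball
    rw [Measure.addHaar_ball_of_pos μ _ hl0, Measure.addHaar_image_linearMap] at h1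
    have hB0 : μ (ball (0 : E) 1) ≠ 0 := (measure_ball_pos μ (0 : E) one_pos).ne'
    have hBtop : μ (ball (0 : E) 1) ≠ ⊤ := measure_ball_lt_top.ne
    have h2 : ENNReal.ofReal (l ^ finrank ℝ E) ≤ ENNReal.ofReal |LinearMap.det f| :=
      (ENNReal.mul_le_mul_iff_left hB0 hBtop).1 h1
    exact (ENNReal.ofReal_le_ofReal_iff (abs_nonneg _)).1 h2

omit [NormedAddCommGroup E] [NormedSpace ℝ E] in
/-- The sharpness companion: a homothety `f = λ·id` has `det f = λ^(dim E)`. [folklore] -/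
theorem det_eq_pow_finrank_of_eq_smul {E : Type*} [AddCommGroup E] [Module ℝ E] [FiniteDimensional ℝ E]
    (f : E →ₗ[ℝ] E) {l : ℝ} (hf : ∀ x, f x = l • x) : LinearMap.det f = l ^ finrank ℝ E := by
  have h : f = l • LinearMap.id := by ext x; simp [hf x]
  rw [h, LinearMap.det_smul, LinearMap.det_id, mul_one]

end Generic

/-! ## §2 The Lie algebra `𝔲(N)` (pub-balaban's `lieU`, pinned Hilbert–Schmidt norm): `‖X‖² = hs X X`, `dim = N²`, and §1 in `hs`-form -/

section LieU

open Module

variable {m : Type*} [Fintype m] [DecidableEq m]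

omit [DecidableEq m] in
/-- On `𝔲(N)` with its pinned Hilbert–Schmidt inner product (pub-balaban's `instInnerProductSpaceLieU`, induced from the tree's
`frobeniusInnerProductSpace`), `‖X‖² = ⟪X, X⟫ = Re tr(Xᴴ X) = hs X X` — definitionally. [folklore] -/
theorem norm_sq_eq_hs (X : lieU m) : ‖X‖ ^ 2 = hs (X : Matrix m m ℂ) (X : Matrix m m ℂ) := by
  rw [← real_inner_self_eq_norm_sq]
  rfl

/-- `dim_ℝ 𝔲(N) = N²` for pub-balaban's `lieU` (`QuantumLattice.finrank_skewAdjoint_submodule`). [folklore] -/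
theorem finrank_lieU : finrank ℝ (lieU m) = Fintype.card m ^ 2 :=
  Literature.MathematicalPhysics.QuantumLattice.finrank_skewAdjoint_submodule

/-- **§1 in Hilbert–Schmidt form on `𝔲(N)`**: an `ℝ`-linear endomorphism `T` of `𝔲(N)` with `λ²·hs(X,X) ≤ hs(TX,TX)` (`λ ≥ 0`)
has `λ^(N²) ≤ |det T|`. [folklore] -/
theorem pow_card_sq_le_abs_det_of_hs_le (T : lieU m →ₗ[ℝ] lieU m) {l : ℝ} (hl : 0 ≤ l)
    (hT : ∀ X : lieU m, l ^ 2 * hs (X : Matrix m m ℂ) (X : Matrix m m ℂ)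
      ≤ hs ((T X : lieU m) : Matrix m m ℂ) ((T X : lieU m) : Matrix m m ℂ)) :
    l ^ (Fintype.card m ^ 2) ≤ |LinearMap.det T| := by
  rw [← finrank_lieU]
  refine pow_finrank_le_abs_det_of_mul_norm_le T hl fun X => ?_
  have h1 : (l * ‖X‖) ^ 2 ≤ ‖T X‖ ^ 2 := by
    rw [mul_pow, norm_sq_eq_hs, norm_sq_eq_hs]; exact hT X
  exact (pow_le_pow_iff_left₀ (mul_nonneg hl (norm_nonneg _)) (norm_nonneg _) two_ne_zero).1 h1

end LieU

/-! ## §3 TANGENCY: `K_W* · D K_W (W X)` is skew-Hermitian for skew-Hermitian `X` -/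

section Tangency

open scoped Matrix.Norms.L2Operator
open Filter Topology

variable {m : Type*} [Fintype m] [DecidableEq m] [Nonempty m] {ι : Type*} [Fintype ι]

omit [Nonempty m] in
/-- **`K` maps the guarded unitaries into `U(N)`**: for unitary `M` and unitaries `hᵢ` with `‖hᵢ M* − 1‖ < 1∕2`, every
`log(hᵢ M*)` is skew-Hermitian (`star_mlog_of_unitary`), so `exp(Σ cᵢ log(hᵢ M*))` is unitary and so is
`Kmat h c M = exp(Σ cᵢ log(hᵢ M*))·M`. [folklore] -/
theorem kmat_mem_unitaryGroup {h : ι → Matrix m m ℂ} (hh : ∀ i, h i ∈ unitaryGroup m ℂ) {M : Matrix m m ℂ}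
    (hM : M ∈ unitaryGroup m ℂ) (hg : ∀ i, ‖h i * star M - 1‖ < 1 / 2) (c : ι → ℝ) :
    Kmat h c M ∈ unitaryGroup m ℂ := by
  have hPu : ∀ i, h i * star M ∈ unitaryGroup m ℂ := fun i => mul_mem (hh i) (Unitary.star_mem hM)
  have hZ : ∀ i, (mlog (h i * star M))ᴴ = -mlog (h i * star M) := fun i => by
    rw [← Matrix.star_eq_conjTranspose]; exact star_mlog_of_unitary (hPu i) (hg i)
  have hY : star (∑ i, (c i : ℂ) • mlog (h i * star M)) = -∑ i, (c i : ℂ) • mlog (h i * star M) := by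
    rw [Matrix.star_eq_conjTranspose]; exact conjTranspose_sum_smul c hZ
  exact mul_mem (exp_mem_unitaryGroup_of_mem_lieU (mem_lieU_iff.2 hY)) hM

omit [Nonempty m] in
/-- The curve `t ↦ W·exp(tX)` has velocity `W X` at `t = 0`. [folklore] -/
theorem hasDerivAt_mul_exp_smul (W X : Matrix m m ℂ) :
    HasDerivAt (fun t : ℝ => W * exp (t • X)) (W * X) 0 := by
  have h := (hasDerivAt_exp_smul_const (𝕂 := ℝ) X (0 : ℝ)).const_mul W
  simpa only [zero_smul, exp_zero, one_mul] using h

omit [Nonempty m] in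
/-- The curve `t ↦ W·exp(tX)` stays in `U(N)` for unitary `W` and skew-Hermitian `X`. [folklore] -/
theorem mul_exp_smul_mem_unitaryGroup {W : Matrix m m ℂ} (hWu : W ∈ unitaryGroup m ℂ) {X : Matrix m m ℂ}
    (hX : Xᴴ = -X) (t : ℝ) : W * exp (t • X) ∈ unitaryGroup m ℂ := by
  refine mul_mem hWu (exp_mem_unitaryGroup_of_mem_lieU (mem_lieU_iff.2 ?_))
  rw [star_smul, star_trivial, Matrix.star_eq_conjTranspose, hX, smul_neg]

/-- **The chain rule along the curve**: `d∕dt K(W·exp(tX))|_{t=0} = D K_W (W X)` (pub-balaban's `hasStrictFDerivAt_Kmat`). [folklore] -/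
theorem hasDerivAt_kmat_mul_exp_smul {h : ι → Matrix m m ℂ} {W : Matrix m m ℂ} (hW : ∀ i, ‖h i * star W - 1‖ < 1)
    (c : ι → ℝ) (X : Matrix m m ℂ) :
    HasDerivAt (fun t : ℝ => Kmat h c (W * exp (t • X))) (emlD h c W (W * X)) 0 := by
  have h1 := hasDerivAt_mul_exp_smul W X
  have h2 := (hasStrictFDerivAt_Kmat h c hW).hasFDerivAt
  have h0 : W = W * exp ((0 : ℝ) • X) := by rw [zero_smul, exp_zero, mul_one]
  exact h2.comp_hasDerivAt_of_eq (0 : ℝ) h1 h0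

/-- ★ **TANGENCY.**  For unitary `W`, unitaries `hᵢ` in the guard `‖hᵢW* − 1‖ < 1∕2` and skew-Hermitian `X`, the
left-trivialised derivative `K_W* · D K_W (W X)` is skew-Hermitian: differentiate `K(W e^{tX})* K(W e^{tX}) = 1` (valid for
small `t`, the guard being open) at `t = 0`. [folklore] -/
theorem star_kmat_mul_emlD_skew {h : ι → Matrix m m ℂ} (hh : ∀ i, h i ∈ unitaryGroup m ℂ) {W : Matrix m m ℂ}
    (hWu : W ∈ unitaryGroup m ℂ) (hg : ∀ i, ‖h i * star W - 1‖ < 1 / 2) (c : ι → ℝ) {X : Matrix m m ℂ}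
    (hX : Xᴴ = -X) :
    (star (Kmat h c W) * emlD h c W (W * X))ᴴ = -(star (Kmat h c W) * emlD h c W (W * X)) := by
  set γ : ℝ → Matrix m m ℂ := fun t => W * exp (t • X) with hγ
  set g : ℝ → Matrix m m ℂ := fun t => Kmat h c (γ t) with hgdef
  set E : Matrix m m ℂ := emlD h c W (W * X)
  have hW1 : ∀ i, ‖h i * star W - 1‖ < 1 := fun i => (hg i).trans (by norm_num)
  have hgd : HasDerivAt g E 0 := hasDerivAt_kmat_mul_exp_smul hW1 c X
  have hγ0 : γ 0 = W := by simp [hγ]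
  have hg0 : g 0 = Kmat h c W := by simp [hgdef, hγ0]
  -- the guard is open along the curve
  have hγd : HasDerivAt γ (W * X) 0 := hasDerivAt_mul_exp_smul W X
  have hγc : Tendsto γ (𝓝 0) (𝓝 W) := by
    have := hγd.continuousAt.tendsto
    rwa [hγ0] at this
  have hev : ∀ᶠ t in 𝓝 (0 : ℝ), ∀ i, ‖h i * star (γ t) - 1‖ < 1 / 2 := by
    refine eventually_all.2 fun i => ?_
    have hF : Continuous fun M : Matrix m m ℂ => ‖h i * star M - 1‖ :=
      ((continuous_const.mul continuous_star).sub continuous_const).norm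
    exact ((hF.tendsto W).comp hγc).eventually_lt_const (hg i)
  -- so `g t` is unitary near `t = 0`, i.e. `(g t)* g t = 1` eventually
  have hev1 : (fun t => star (g t) * g t) =ᶠ[𝓝 (0 : ℝ)] fun _ => (1 : Matrix m m ℂ) := by
    filter_upwards [hev] with t ht
    exact Matrix.mem_unitaryGroup_iff'.mp
      (kmat_mem_unitaryGroup hh (mul_exp_smul_mem_unitaryGroup hWu hX t) ht c)
  -- differentiate
  have hprod : HasDerivAt (fun t => star (g t) * g t) (star E * g 0 + star (g 0) * E) 0 := hgd.star.mul hgd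
  have hconst : HasDerivAt (fun t => star (g t) * g t) (0 : Matrix m m ℂ) 0 :=
    (hasDerivAt_const (0 : ℝ) (1 : Matrix m m ℂ)).congr_of_eventuallyEq hev1
  have hzero : star E * g 0 + star (g 0) * E = 0 := hprod.unique hconst
  rw [hg0] at hzero
  rw [Matrix.conjTranspose_mul, ← Matrix.star_eq_conjTranspose, ← Matrix.star_eq_conjTranspose, star_star]
  exact eq_neg_of_add_eq_zero_left hzero

/-- The left-trivialised derivative maps `𝔲(N)` into `𝔲(N)` (membership form of `star_kmat_mul_emlD_skew`). [folklore] -/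
theorem star_kmat_mul_emlD_mem_lieU {h : ι → Matrix m m ℂ} (hh : ∀ i, h i ∈ unitaryGroup m ℂ) {W : Matrix m m ℂ}
    (hWu : W ∈ unitaryGroup m ℂ) (hg : ∀ i, ‖h i * star W - 1‖ < 1 / 2) (c : ι → ℝ) {X : Matrix m m ℂ}
    (hX : X ∈ lieU m) : star (Kmat h c W) * emlD h c W (W * X) ∈ lieU m := by
  rw [mem_lieU_iff] at hX ⊢
  have hX' : Xᴴ = -X := by rw [← Matrix.star_eq_conjTranspose, hX]
  rw [Matrix.star_eq_conjTranspose]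
  exact star_kmat_mul_emlD_skew hh hWu hg c hX'

end Tangency

/-! ## §4 THE DETERMINANT FORM of the sharp Jacobian bound -/

section Determinant

open scoped Matrix.Norms.L2Operator
open Module

variable {m : Type*} [Fintype m] [DecidableEq m] [Nonempty m] {ι : Type*} [Fintype ι]

/-- ★ **THE LEFT-TRIVIALISED TANGENT MAP EXISTS AS AN ENDOMORPHISM OF `𝔲(N)`** (non-vacuity of the `T` below — A6): on the
guard there is an `ℝ`-linear `T : 𝔲(N) → 𝔲(N)` with `T X = K_W* · D K_W (W X)`. [folklore] -/
theorem exists_leftTangent_lieU {h : ι → Matrix m m ℂ} (hh : ∀ i, h i ∈ unitaryGroup m ℂ) {W : Matrix m m ℂ}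
    (hWu : W ∈ unitaryGroup m ℂ) (hg : ∀ i, ‖h i * star W - 1‖ < 1 / 2) (c : ι → ℝ) :
    ∃ T : lieU m →ₗ[ℝ] lieU m, ∀ X : lieU m,
      ((T X : lieU m) : Matrix m m ℂ) = star (Kmat h c W) * emlD h c W (W * (X : Matrix m m ℂ)) := by
  let F : Matrix m m ℂ →ₗ[ℝ] Matrix m m ℂ :=
    (LinearMap.mulLeft ℝ (star (Kmat h c W))) ∘ₗ (emlD h c W).toLinearMap ∘ₗ (LinearMap.mulLeft ℝ W)
  have hF : ∀ X : Matrix m m ℂ, F X = star (Kmat h c W) * emlD h c W (W * X) := fun X => rfl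
  refine ⟨F.restrict (p := lieU m) (q := lieU m) fun X hX => ?_, fun X => rfl⟩
  rw [hF]
  exact star_kmat_mul_emlD_mem_lieU hh hWu hg c hX

omit [Nonempty m] in
/-- `hs` is invariant under left multiplication by a unitary: `hs (U A) (U B) = hs A B` for `U* U = 1`. [folklore] -/
theorem hs_unitary_mul {U : Matrix m m ℂ} (hU : star U * U = 1) (A B : Matrix m m ℂ) :
    hs (U * A) (U * B) = hs A B := by
  rw [hs, hsC_mul_left, hs, ← Matrix.mul_assoc, ← Matrix.star_eq_conjTranspose, hU, Matrix.one_mul]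

/-- ★★★ **THE DETERMINANT FORM OF THE SHARP JACOBIAN BOUND.**  For unitary `W`, unitaries `hᵢ` in the guard
`‖hᵢW* − 1‖ < 1∕2`, weights `cᵢ ≥ 0` with `Σcᵢ ≤ 1`, and ANY `ℝ`-linear endomorphism `T` of `𝔲(N)` agreeing with the
left-trivialised tangent map, `T X = K_W* · D K_W (W X)` (one exists: `exists_leftTangent_lieU`):
  `(1 − Σcᵢ)^(N²) ≤ |det T|`.
The singular values of `D K_W` on `𝔲(N)` are `≥ 1 − Σcᵢ` in Hilbert–Schmidt norm (`emlD_tangent_lower_bound_sharp`, left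
multiplication by the unitary `K_W*` being an `hs`-isometry), and §1 turns this into the determinant bound; equality at the flat
background (`det_leftTangent_flat`). [folklore] -/
theorem pow_card_sq_le_abs_det_leftTangent {h : ι → Matrix m m ℂ} (hh : ∀ i, h i ∈ unitaryGroup m ℂ) {W : Matrix m m ℂ}
    (hWu : W ∈ unitaryGroup m ℂ) (hg : ∀ i, ‖h i * star W - 1‖ < 1 / 2) {c : ι → ℝ} (hc0 : ∀ i, 0 ≤ c i)
    (hc1 : ∑ i, c i ≤ 1) (T : lieU m →ₗ[ℝ] lieU m)
    (hT : ∀ X : lieU m, ((T X : lieU m) : Matrix m m ℂ) = star (Kmat h c W) * emlD h c W (W * (X : Matrix m m ℂ))) :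
    (1 - ∑ i, c i) ^ (Fintype.card m ^ 2) ≤ |LinearMap.det T| := by
  have hKu : star (Kmat h c W) * Kmat h c W = 1 :=
    Matrix.mem_unitaryGroup_iff'.mp (kmat_mem_unitaryGroup hh hWu hg c)
  have hKu' : star (star (Kmat h c W)) * star (Kmat h c W) = 1 := by
    rw [star_star]; exact Matrix.mem_unitaryGroup_iff.mp (kmat_mem_unitaryGroup hh hWu hg c)
  refine pow_card_sq_le_abs_det_of_hs_le T (by linarith) fun X => ?_
  have hX : ((X : lieU m) : Matrix m m ℂ)ᴴ = -(X : Matrix m m ℂ) := by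
    rw [← Matrix.star_eq_conjTranspose]; exact mem_lieU_iff.1 X.2
  rw [hT X, hs_unitary_mul hKu']
  exact emlD_tangent_lower_bound_sharp hh hWu hg hc0 hc1 (X : Matrix m m ℂ) hX

/-- ★ **SHARPNESS AT THE FLAT BACKGROUND.**  If every `hᵢ = W` then `T = (1 − Σcᵢ)·id` on `𝔲(N)` (`GuardJacobian.emlD_flat`,
`K_W = W`), so `det T = (1 − Σcᵢ)^(N²)`: the exponent and the base of `pow_card_sq_le_abs_det_leftTangent` are attained. [folklore] -/
theorem det_leftTangent_flat {W : Matrix m m ℂ} (hWu : W ∈ unitaryGroup m ℂ) (c : ι → ℝ) (T : lieU m →ₗ[ℝ] lieU m)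
    (hT : ∀ X : lieU m, ((T X : lieU m) : Matrix m m ℂ)
      = star (Kmat (fun _ : ι => W) c W) * emlD (fun _ : ι => W) c W (W * (X : Matrix m m ℂ))) :
    LinearMap.det T = (1 - ∑ i, c i) ^ (Fintype.card m ^ 2) := by
  have hW1 : star W * W = 1 := Matrix.mem_unitaryGroup_iff'.mp hWu
  have hW2 : W * star W = 1 := Matrix.mem_unitaryGroup_iff.mp hWu
  have hK : Kmat (fun _ : ι => W) c W = W := by
    show exp (∑ i, (c i : ℂ) • mlog (W * star W)) * W = W
    rw [hW2, MatrixLog.mlog_one]; simp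
  rw [← finrank_lieU]
  refine det_eq_pow_finrank_of_eq_smul T fun X => Subtype.ext ?_
  have hX : ((X : lieU m) : Matrix m m ℂ)ᴴ = -(X : Matrix m m ℂ) := by
    rw [← Matrix.star_eq_conjTranspose]; exact mem_lieU_iff.1 X.2
  rw [hT X, hK, emlD_flat hWu c _ hX, Matrix.mul_smul, ← Matrix.mul_assoc, hW1, Matrix.one_mul, Submodule.coe_smul,
    Complex.coe_smul]

/-- ★★ **AT THE TYPED GUARD OF THE PRINTED AVERAGE ON `SU(N)`** (`ExpMeanLog.deltaSU = min(1∕3, π∕N)`): for `hᵢ, W ∈ SU(N)` with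
`‖hᵢW* − 1‖ < deltaSU` and `cᵢ ≥ 0`, `Σcᵢ ≤ 1`, every `ℝ`-linear endomorphism `T` of `𝔲(N)` agreeing with `K_W* · D K_W (W ·)` has
`(1 − Σcᵢ)^(N²) ≤ |det T|` — one `W`-uniform constant on the whole guard, every `N`. [folklore] -/
theorem pow_card_sq_le_abs_det_leftTangent_specialUnitary {n : Type} [DecidableEq n] [Fintype n] [Nonempty n]
    (h : ι → Matrix.specialUnitaryGroup n ℂ) (W : Matrix.specialUnitaryGroup n ℂ)
    (hg : ∀ i, ‖(h i : Matrix n n ℂ) * star (W : Matrix n n ℂ) - 1‖ < ExpMeanLog.deltaSU n)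
    {c : ι → ℝ} (hc0 : ∀ i, 0 ≤ c i) (hc1 : ∑ i, c i ≤ 1) (T : lieU n →ₗ[ℝ] lieU n)
    (hT : ∀ X : lieU n, ((T X : lieU n) : Matrix n n ℂ)
      = star (Kmat (fun i => (h i : Matrix n n ℂ)) c W) * emlD (fun i => (h i : Matrix n n ℂ)) c W (W * (X : Matrix n n ℂ))) :
    (1 - ∑ i, c i) ^ (Fintype.card n ^ 2) ≤ |LinearMap.det T| := by
  have hh : ∀ i, (h i : Matrix n n ℂ) ∈ unitaryGroup n ℂ := fun i => (Matrix.mem_specialUnitaryGroup_iff.mp (h i).2).1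
  have hWu : (W : Matrix n n ℂ) ∈ unitaryGroup n ℂ := (Matrix.mem_specialUnitaryGroup_iff.mp W.2).1
  have hg' : ∀ i, ‖(h i : Matrix n n ℂ) * star (W : Matrix n n ℂ) - 1‖ < 1 / 2 := fun i => by
    have := ExpMeanLog.lt_third_of_lt_deltaSU (hg i); linarith
  exact pow_card_sq_le_abs_det_leftTangent hh hWu hg' hc0 hc1 T hT

end Determinant

end Summit.QuantumFields.YangMills.BalabanUVNodes.N08HaarCompatibilityGuardJacobianDet

end
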